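import Literature.Probability.Percolation.TwoArmScalingLimitFromLoops
import HarnessLib

/-!
# The no-touching hypothesis of the two-arm scaling limit, reduced to the lattice

Topic: Probability / Percolation. Proof-only sequel of `TwoArmScalingLimitFromLoops.lean`, which
derives the named fact `SmirnovWerner2001_twoArm_scalingLimit` (S. Smirnov, W. Werner, Math. Res.
Lett. **8** (2001), §4, (16) with (9), `j = 2`) from (a) the convergence in law of the
critical-percolation loop collections (the Camia–Newman fact `exists_isCNLFamily_tendsto`), (b) a
**no-touching** property of the limit law at the hexagonal annuli `r ≤ N ≤ R` (the near-miss
event "every `ε`-near crossing exists but no member crosses strictly" is null) and (c) the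
exponent `-1/4` of the continuum crossing probabilities. Here hypothesis (b) is reduced to a
statement about the lattice model alone, in the way such continuum regularity is always obtained
(F. Camia, C. M. Newman, Comm. Math. Phys. 268 (2006), §6: arm estimates uniform in the mesh,
passed to the limit by portmanteau):

* `triLoopCollection_mem_loopHexCrossing_of_mem_armEvent`,
  `mem_armEvent_of_triLoopCollection_mem_loopHexCrossing` — the sandwich of
  `TwoArmScalingLimitFromLoops.lean` for ARBITRARY integer radii `n ≤ N` at mesh `ρ⁻¹`
  (`armEvent n N ⇒ Cross((n+1)/ρ, (N-1)/ρ)`; `Cross(a, b) ⇒ armEvent n N` whenever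
  `ρa + 6 ≤ n ≤ N ≤ ρb - 6`);
* `mem_interior_loopHexCrossing`, `exists_mem_of_mem_closure_loopHexCrossing` — strict crossings
  are interior points of `Cross(a, b)`, closure points nearly cross (Hausdorff-metric bookkeeping
  on `LoopSpace`);
* **`measure_nearMiss_le_liminf`** — for a limit law `P'` of the loop collections in
  `D ⊇ B̄(0, R₂ + 1)` and radii `0 < r₂ < r < r₁ < R₁ < R < R₂`:
  `P'(near-miss of (r, R)) ≤ liminf_ρ P[armEvent ⌈ρr₁⌉ ⌊ρR₁⌋ ∖ armEvent ⌊ρr₂⌋ ⌈ρR₂⌉]`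
  — the near-miss event lies in the open set `interior Cross(r+3ε, R-3ε) ∖ closure Cross(r-2ε', R+2ε')`,
  whose `P'`-mass is bounded by the `liminf` of its lattice probabilities (portmanteau, open-set
  half), and at mesh `ρ⁻¹` that open set forces two arms of opposite colours across
  `[ρr₁, ρR₁]` but forbids them across `[ρr₂, ρR₂]` (the sandwich);
* `measure_nearMiss_eq_zero_of_lattice` — hence (b) holds as soon as these **lattice
  inextendability probabilities** are small for nearby radii, uniformly in the scale;
* `SmirnovWerner2001_twoArm_scalingLimit_of_loopLimit_of_lattice`, `…_of_cnl_of_lattice` — the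
  named fact from (a), the lattice equicontinuity, and (c).

The lattice equicontinuity itself — `P[armEvent n₁ N ∖ armEvent n₂ N] → 0` as `n₂/n₁ → 1`
uniformly in `N ≥ 2n₁`, and symmetrically in the outer radius — is the standard consequence of the
half-plane three-arm bound (`LawlerSchrammWerner2002_halfPlane_threeArm`, `HalfPlaneThreeArm.lean`:
a crossing interface that cannot be pushed to the next level makes a U-turn at its extremal level,
producing three half-plane arms) and is NOT proved in this file. Everything here is proved; no
definitions and no named facts are introduced.

## References

* S. Smirnov, W. Werner, Math. Res. Lett. 8 (2001) 729–744, §4 (9), (16) [SmirnovWernerMRL2001].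
* F. Camia, C. M. Newman, Comm. Math. Phys. 268 (2006), §6 (Lemmas 6.1–6.4) [CamiaNewman2006].
* P. Billingsley, *Convergence of probability measures*, 2nd ed. (1999), Thm 2.1 [Billingsley1999].
-/

noncomputable section

open Set Metric Complex Filter MeasureTheory
open Literature.Topology.PlaneTopology Literature.Probability.RandomPlanarGeometry
open scoped unitInterval Topology ENNReal

namespace Literature.Probability.Percolation

open LatticeModels

/-! ### The sandwich for arbitrary integer radii -/

/-- Sites of `Λ_N` have their mesh-`ρ⁻¹` points in the closed disc of radius `N/ρ`. [folklore] -/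
theorem norm_triMeshPoint_inv_le_div {ρ : ℕ} (hρ : 1 ≤ ρ) {N : ℕ} {v : Site 2} (hv : triNorm v ≤ N) :
    ‖triMeshPoint (ρ : ℝ)⁻¹ v‖ ≤ (N : ℝ) / ρ := by
  have hρ' : (0 : ℝ) < ρ := by exact_mod_cast hρ
  rw [triMeshPoint, norm_mul, Complex.norm_real, Real.norm_eq_abs, abs_of_pos (inv_pos.2 hρ'),
    le_div_iff₀ hρ', mul_comm, ← mul_assoc, mul_inv_cancel₀ hρ'.ne', one_mul]
  calc ‖triEmbed v‖ ≤ triNorm v := norm_triEmbed_le_triNorm v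
    _ ≤ (N : ℝ) := by exact_mod_cast hv

/-- The arm event of `Λ_N ∖ Λ̊_n` is not affected by closing the sites whose mesh-`ρ⁻¹` points lie
outside a set containing the closed disc of radius `N/ρ` (`determinedBy_armEvent`). [folklore] -/
theorem mem_armEvent_inter_triMeshVertices_iff' {k : ℕ} (κ : Fin k → Bool) {n N ρ : ℕ} (hρ : 1 ≤ ρ)
    (hnN : n ≤ N) {Ω : Set ℂ} (hΩ : closedBall (0 : ℂ) ((N : ℝ) / ρ) ⊆ Ω) (ω : SiteConfig (Site 2)) :
    ω ∩ triMeshVertices Ω (ρ : ℝ)⁻¹ ∈ armEvent κ n N ↔ ω ∈ armEvent κ n N := by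
  have hdet := (determinedBy_iff _ _).1 (determinedBy_armEvent κ hnN)
  have hsub : (↑(triAnnulus n N) : Set (Site 2)) ⊆ triMeshVertices Ω (ρ : ℝ)⁻¹ := by
    intro v hv
    rw [Finset.mem_coe, mem_triAnnulus] at hv
    exact hΩ (mem_closedBall_zero_iff.2 (norm_triMeshPoint_inv_le_div hρ hv.2))
  refine hdet _ _ ?_
  rw [Set.inter_assoc, Set.inter_eq_right.2 hsub]

/-- **Arms give a crossing of the loop collection** (arbitrary integer radii `1 ≤ n ≤ N`, mesh
`ρ⁻¹`, domain containing the closed disc of radius `N/ρ`): some member of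
`triLoopCollection D ρ⁻¹ ω` meets `{N ≤ (n+1)/ρ}` and `{N ≥ (N-1)/ρ}`.
[cite: SmirnovWernerMRL2001, §4 Remark 6 and (15)] -/
theorem triLoopCollection_mem_loopHexCrossing_of_mem_armEvent {n N ρ : ℕ} (hn : 1 ≤ n) (hnN : n ≤ N)
    (hρ : 1 ≤ ρ) (D : JordanDomain) (hD : closedBall (0 : ℂ) ((N : ℝ) / ρ) ⊆ D.carrier) {ω : SiteConfig (Site 2)}
    (hω : ω ∈ armEvent ![true, false] n N) :
    triLoopCollection D (ρ : ℝ)⁻¹ ω ∈ loopHexCrossing (((n : ℝ) + 1) / ρ) (((N : ℝ) - 1) / ρ) := by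
  set δ : ℝ := (ρ : ℝ)⁻¹ with hδdef
  have hρ' : (0 : ℝ) < ρ := by exact_mod_cast hρ
  have hδ : 0 < δ := inv_pos.2 hρ'
  set ω' : SiteConfig (Site 2) := ω ∩ triMeshVertices D.carrier δ with hω'
  have hfin : ω'.Finite := (triMeshVertices_finite_holds D.isBounded hδ).subset inter_subset_right
  have hω'arm : ω' ∈ armEvent ![true, false] n N := (mem_armEvent_inter_triMeshVertices_iff' _ hρ hnN hD ω).2 hω
  obtain ⟨F, w, hw, ⟨z₁, hz₁, v₁, hv₁, hd₁⟩, z₂, hz₂, v₂, hv₂, hd₂⟩ :=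
    exists_isSiteInterfaceLoop_polyTrace_of_mem_armEvent_two hfin hn hnN hω'arm hδ
  have hlen : 0 < w.length := by have := hw.isCycle.three_le_length; omega
  refine ⟨siteLoopCurve δ w, siteLoopCurve_mem_triLoopCollection hw, ?_, ?_⟩
  · refine ⟨z₁, by rw [range_siteLoopCurve hlen]; exact hz₁, ?_⟩
    have h1 := hexGauge_le_hexGauge_add z₁ (triMeshPoint δ v₁)
    rw [hexGauge_triMeshPoint hδ.le, ← dist_eq_norm] at h1
    have hv₁' : (triNorm v₁ : ℝ) = n - 1 := by
      have : (triNorm v₁ : ℝ) + 1 = ((n : ℕ) : ℤ) := by exact_mod_cast hv₁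
      push_cast at this; linarith
    rw [hv₁'] at h1
    calc hexGauge z₁ ≤ δ * (n - 1) + 2 * dist z₁ (triMeshPoint δ v₁) := h1
      _ ≤ δ * (n - 1) + 2 * δ := by linarith
      _ = ((n : ℝ) + 1) / ρ := by rw [hδdef, div_eq_inv_mul]; ring
  · refine ⟨z₂, by rw [range_siteLoopCurve hlen]; exact hz₂, ?_⟩
    have h2 := hexGauge_le_hexGauge_add (triMeshPoint δ v₂) z₂
    rw [hexGauge_triMeshPoint hδ.le, ← dist_eq_norm, dist_comm] at h2
    have hv₂' : (triNorm v₂ : ℝ) = N + 1 := by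
      have : (triNorm v₂ : ℝ) = ((N : ℕ) : ℤ) + 1 := by exact_mod_cast hv₂
      push_cast at this; linarith
    rw [hv₂'] at h2
    calc ((N : ℝ) - 1) / ρ = δ * (N + 1) - 2 * δ := by rw [hδdef, div_eq_inv_mul]; ring
      _ ≤ δ * (N + 1) - 2 * dist z₂ (triMeshPoint δ v₂) := by linarith
      _ ≤ hexGauge z₂ := by linarith

/-- **A crossing of the loop collection gives the arms** (arbitrary radii): if some member of
`triLoopCollection D ρ⁻¹ ω` meets `{N ≤ a}` and `{N ≥ b}`, then `ω ∈ armEvent (open, closed) n N`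
for all integer radii `n ≤ N` with `ρ a + 6 ≤ n` and `N ≤ ρ b - 6` (domain containing the closed
disc of radius `N/ρ`). [cite: SmirnovWernerMRL2001, §4 Remark 6 and (15)] -/
theorem mem_armEvent_of_triLoopCollection_mem_loopHexCrossing {n N ρ : ℕ} (hρ : 1 ≤ ρ) {a b : ℝ}
    (hn : (ρ : ℝ) * a + 6 ≤ n) (hN : (N : ℝ) ≤ ρ * b - 6) (hnN : n ≤ N) (D : JordanDomain)
    (hD : closedBall (0 : ℂ) ((N : ℝ) / ρ) ⊆ D.carrier) {ω : SiteConfig (Site 2)}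
    (h : triLoopCollection D (ρ : ℝ)⁻¹ ω ∈ loopHexCrossing a b) :
    ω ∈ armEvent ![true, false] n N := by
  set δ : ℝ := (ρ : ℝ)⁻¹ with hδdef
  have hρ' : (0 : ℝ) < ρ := by exact_mod_cast hρ
  have hδ : 0 < δ := inv_pos.2 hρ'
  have hδρ : δ * ρ = 1 := inv_mul_cancel₀ hρ'.ne'
  set ω' : SiteConfig (Site 2) := ω ∩ triMeshVertices D.carrier δ with hω'
  rw [← mem_armEvent_inter_triMeshVertices_iff' _ hρ hnN hD ω]
  obtain ⟨c, hc, ⟨z₁, hz₁, h1⟩, z₂, hz₂, h2⟩ := h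
  have ha0 : 0 ≤ a := (hexGauge_nonneg z₁).trans h1
  -- a nearby interface loop of the restricted configuration
  have hc' : c ∈ closure {c | ∃ (f : HexVertex) (γ : hexGraph.Walk f f),
      IsSiteInterfaceLoop ω' γ ∧ c = siteLoopCurve δ γ} := hc
  obtain ⟨c', ⟨f, γ, hγ, rfl⟩, hcc'⟩ := Metric.mem_closure_iff.1 hc' (δ / 2) (by positivity)
  have hlen : 0 < γ.length := by have := hγ.isCycle.three_le_length; omega
  obtain ⟨γc, rfl⟩ := CurveClass.surjective_mk c
  have hdist : dist γc ⟨γ.toCurve fun v ↦ (δ : ℂ) * hexCenter v⟩ < δ / 2 := by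
    rwa [siteLoopCurve, CurveClass.mk_eq_separationQuotientMk, SeparationQuotient.dist_mk] at hcc'
  have hrange : Curve.range (⟨γ.toCurve fun v ↦ (δ : ℂ) * hexCenter v⟩ : Curve ℂ) = polyTrace δ γ :=
    range_toCurve_eq_polyTrace hlen
  have hne : (polyTrace δ γ).Nonempty := by rw [← hrange]; exact Curve.range_nonempty _
  have key : ∀ {z : ℂ}, z ∈ CurveClass.range (CurveClass.mk γc) → ∃ z' ∈ polyTrace δ γ, dist z z' < δ / 2 := by
    intro z hz
    rw [CurveClass.range_mk] at hz
    obtain ⟨t, rfl⟩ := Curve.mem_range.1 hz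
    have := (Curve.infDist_range_le γc ⟨γ.toCurve fun v ↦ (δ : ℂ) * hexCenter v⟩ t).trans_lt hdist
    rw [hrange] at this
    exact (Metric.infDist_lt_iff hne).1 this
  obtain ⟨z₁', hz₁', hd₁⟩ := key hz₁
  obtain ⟨z₂', hz₂', hd₂⟩ := key hz₂
  obtain ⟨v₁, hv₁'⟩ := exists_dist_triMeshPoint_le hδ z₁'
  obtain ⟨v₂, hv₂'⟩ := exists_dist_triMeshPoint_le hδ z₂'
  have hv₁ : dist z₁' (triMeshPoint δ v₁) ≤ δ := hv₁'.trans (by linarith)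
  have hv₂ : dist z₂' (triMeshPoint δ v₂) ≤ δ := hv₂'.trans (by linarith)
  have hN₁ : δ * triNorm v₁ ≤ a + 3 * δ := by
    have e1 := hexGauge_le_hexGauge_add (triMeshPoint δ v₁) z₁'
    have e2 := hexGauge_le_hexGauge_add z₁' z₁
    rw [hexGauge_triMeshPoint hδ.le, ← dist_eq_norm, dist_comm] at e1
    rw [← dist_eq_norm, dist_comm] at e2
    linarith
  have hN₂ : b - 3 * δ ≤ δ * triNorm v₂ := by
    have e1 := hexGauge_le_hexGauge_add z₂' (triMeshPoint δ v₂)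
    have e2 := hexGauge_le_hexGauge_add z₂ z₂'
    rw [hexGauge_triMeshPoint hδ.le, ← dist_eq_norm] at e1
    rw [← dist_eq_norm] at e2
    linarith
  -- in lattice units
  have hn6 : 6 ≤ n := by
    have : (6 : ℝ) ≤ n := le_trans (by nlinarith) hn
    exact_mod_cast this
  have hv₁n : triNorm v₁ ≤ ((n - 3 : ℕ) : ℤ) := by
    have h' : (triNorm v₁ : ℝ) ≤ n - 3 := by
      have e : (triNorm v₁ : ℝ) = ρ * (δ * triNorm v₁) := by rw [← mul_assoc, mul_comm (ρ : ℝ), hδρ, one_mul]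
      have e2 : (ρ : ℝ) * (a + 3 * δ) = ρ * a + 3 := by
        rw [show (ρ : ℝ) * (a + 3 * δ) = ρ * a + 3 * (δ * ρ) by ring, hδρ]; ring
      rw [e]
      nlinarith [mul_le_mul_of_nonneg_left hN₁ hρ'.le]
    have h'' : (triNorm v₁ : ℝ) ≤ ((n - 3 : ℕ) : ℤ) := by push_cast [show 3 ≤ n by omega]; exact h'
    exact_mod_cast h''
  have hv₂n : ((N + 3 : ℕ) : ℤ) ≤ triNorm v₂ := by
    have h' : (N : ℝ) + 3 ≤ triNorm v₂ := by
      have e : (triNorm v₂ : ℝ) = ρ * (δ * triNorm v₂) := by rw [← mul_assoc, mul_comm (ρ : ℝ), hδρ, one_mul]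
      rw [e]
      have e2 : (ρ : ℝ) * (b - 3 * δ) = ρ * b - 3 := by
        rw [show (ρ : ℝ) * (b - 3 * δ) = ρ * b - 3 * (δ * ρ) by ring, hδρ]; ring
      nlinarith [mul_le_mul_of_nonneg_left hN₂ hρ'.le]
    have h'' : (((N + 3 : ℕ) : ℤ) : ℝ) ≤ triNorm v₂ := by push_cast; exact h'
    exact_mod_cast h''
  have harm := hγ.mem_armEvent_two_of_polyTrace hδ (r := n - 3) (R := N + 3) (by omega)
    hz₁' hz₂' hv₁n hv₁ hv₂n hv₂
  rwa [show n - 3 + 3 = n by omega, show N + 3 - 3 = N by omega] at harm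

/-! ### Interior and closure of the crossing events -/

/-- **A strict crossing is robust**: a collection with a member meeting `{N < a}` and `{N > b}`
lies in the interior of `Cross(a, b)` (Hausdorff-close collections have a member whose trace is
uniformly close, `exists_mem_hexGauge_near`). [folklore] -/
theorem mem_interior_loopHexCrossing {L : LoopSpace ℂ} {a b : ℝ} {c : CurveClass ℂ} (hc : c ∈ L)
    {z₁ : ℂ} (hz₁ : z₁ ∈ CurveClass.range c) (h₁ : hexGauge z₁ < a)
    {z₂ : ℂ} (hz₂ : z₂ ∈ CurveClass.range c) (h₂ : b < hexGauge z₂) :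
    L ∈ interior (loopHexCrossing a b) := by
  set g : ℝ := min (a - hexGauge z₁) (hexGauge z₂ - b) with hg
  have hgpos : 0 < g := lt_min (by linarith) (by linarith)
  have hg1 : g ≤ a - hexGauge z₁ := min_le_left _ _
  have hg2 : g ≤ hexGauge z₂ - b := min_le_right _ _
  rw [mem_interior_iff_mem_nhds]
  refine Filter.mem_of_superset (Metric.eball_mem_nhds L (show (0 : ℝ≥0∞) < ENNReal.ofReal (g / 4) by
    simpa using (by positivity : (0 : ℝ) < g / 4))) fun L' hL' ↦ ?_
  rw [Metric.mem_eball] at hL'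
  obtain ⟨c', hc', hup, hdown⟩ := exists_mem_hexGauge_near hL' hc
  obtain ⟨w₁, hw₁, hw₁N⟩ := hup z₁ hz₁
  obtain ⟨w₂, hw₂, hw₂N⟩ := hdown z₂ hz₂
  exact ⟨c', hc', ⟨w₁, hw₁, by linarith⟩, w₂, hw₂, by linarith⟩

/-- **Limits of crossing collections nearly cross**: a collection in the closure of `Cross(a, b)`
has, for every `η > 0`, a member meeting `{N ≤ a + η}` and `{N ≥ b - η}`. [folklore] -/
theorem exists_mem_of_mem_closure_loopHexCrossing {L : LoopSpace ℂ} {a b : ℝ}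
    (hL : L ∈ closure (loopHexCrossing a b)) {η : ℝ} (hη : 0 < η) :
    ∃ c ∈ L, (∃ z ∈ CurveClass.range c, hexGauge z ≤ a + η) ∧ ∃ z ∈ CurveClass.range c, b - η ≤ hexGauge z := by
  obtain ⟨L', ⟨c', hc', ⟨z₁, hz₁, h₁⟩, z₂, hz₂, h₂⟩, hLL'⟩ :=
    EMetric.mem_closure_iff.1 hL (ENNReal.ofReal (η / 2)) (by simpa using (by positivity : (0 : ℝ) < η / 2))
  obtain ⟨c, hc, hup, hdown⟩ := exists_mem_hexGauge_near hLL' hc'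
  obtain ⟨w₁, hw₁, hw₁N⟩ := hup z₁ hz₁
  obtain ⟨w₂, hw₂, hw₂N⟩ := hdown z₂ hz₂
  exact ⟨c, hc, ⟨w₁, hw₁, by linarith⟩, w₂, hw₂, by linarith⟩

/-! ### The near-miss probability of the limit is bounded by a lattice inextendability probability -/

/-- **The no-touching null set from the lattice.** Let the loop collections in a Jordan domain
`D ⊇ B̄(0, R₂ + 1)` converge in law to `P'` and let `0 < r₂ < r < r₁ < R₁ < R < R₂`. The
`P'`-measure of the near-miss event of the hexagonal annulus `r ≤ N ≤ R` — every `ε`-near crossing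
exists but no member crosses strictly, the event whose nullity is hypothesis (b) of
`SmirnovWerner2001_twoArm_scalingLimit_of_loopLimit` — is at most
`liminf_ρ P[armEvent (open, closed) ⌈ρr₁⌉ ⌊ρR₁⌋ ∖ armEvent (open, closed) ⌊ρr₂⌋ ⌈ρR₂⌉]`, the
probability that the lattice annulus `[ρr₁, ρR₁]` is crossed by two arms of opposite colours which
cannot be extended to cross `[ρr₂, ρR₂]`. Proof: the near-miss event lies in the open set
`interior Cross(r + 3ε, R - 3ε) ∖ closure Cross(r - 2ε', R + 2ε')`; portmanteau (open-set half,
Mathlib `ProbabilityMeasure.le_liminf_measure_open_of_tendsto`) and the sandwich at mesh `ρ⁻¹`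
(`mem_armEvent_of_triLoopCollection_mem_loopHexCrossing`,
`triLoopCollection_mem_loopHexCrossing_of_mem_armEvent`). This is how the continuum no-touching
property is obtained from RSW/BK arm estimates (Camia–Newman, Comm. Math. Phys. 268 (2006), §6,
Lemmas 6.1–6.4: "close encounters" of loops have vanishing probability via 6-arm and half-plane
3-arm bounds). [cite: CamiaNewman2006, §6] -/
theorem measure_nearMiss_le_liminf (D : JordanDomain) {R₂ : ℝ} (hD : closedBall (0 : ℂ) (R₂ + 1) ⊆ D.carrier)
    {P' : Measure (LoopSpace ℂ)} [IsProbabilityMeasure P']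
    (hconv : TendstoLaw (Ωδ := fun _ ↦ SiteConfig (Site 2)) (fun δ ↦ triLoopCollection D δ)
      (fun _ ↦ triSitePercolation half) id P')
    {r₂ r r₁ R₁ R : ℝ} (h₀ : 0 < r₂) (h₂ : r₂ < r) (h₁ : r < r₁) (h₁₁ : r₁ < R₁) (H₁ : R₁ < R) (H₂ : R < R₂) :
    P' {L : LoopSpace ℂ | (∀ ε > 0, ∃ c ∈ L, (∃ z ∈ CurveClass.range c, hexGauge z ≤ r + ε) ∧
        ∃ z ∈ CurveClass.range c, R - ε ≤ hexGauge z) ∧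
      ¬ ∃ c ∈ L, (∃ z ∈ CurveClass.range c, hexGauge z < r) ∧ ∃ z ∈ CurveClass.range c, R < hexGauge z} ≤
    liminf (fun ρ : ℕ ↦ triSitePercolation half
      (armEvent ![true, false] ⌈(ρ : ℝ) * r₁⌉₊ ⌊(ρ : ℝ) * R₁⌋₊ \
        armEvent ![true, false] ⌊(ρ : ℝ) * r₂⌋₊ ⌈(ρ : ℝ) * R₂⌉₊)) atTop := by
  -- margins
  set ε : ℝ := min (r₁ - r) (R - R₁) / 4 with hε
  set ε' : ℝ := min (r - r₂) (R₂ - R) / 4 with hε'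
  have hm1 : 0 < min (r₁ - r) (R - R₁) := lt_min (by linarith) (by linarith)
  have hm2 : 0 < min (r - r₂) (R₂ - R) := lt_min (by linarith) (by linarith)
  have hεpos : 0 < ε := by positivity
  have hε'pos : 0 < ε' := by positivity
  have hε1 : 4 * ε ≤ r₁ - r := by rw [hε]; linarith [min_le_left (r₁ - r) (R - R₁)]
  have hε2 : 4 * ε ≤ R - R₁ := by rw [hε]; linarith [min_le_right (r₁ - r) (R - R₁)]
  have hε'1 : 4 * ε' ≤ r - r₂ := by rw [hε']; linarith [min_le_left (r - r₂) (R₂ - R)]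
  have hε'2 : 4 * ε' ≤ R₂ - R := by rw [hε']; linarith [min_le_right (r - r₂) (R₂ - R)]
  -- the open set
  set U : Set (LoopSpace ℂ) := interior (loopHexCrossing (r + 3 * ε) (R - 3 * ε)) with hU
  set K : Set (LoopSpace ℂ) := closure (loopHexCrossing (r - 2 * ε') (R + 2 * ε')) with hK
  have hG : IsOpen (U \ K) := isOpen_interior.sdiff isClosed_closure
  have hsub : {L : LoopSpace ℂ | (∀ ε > 0, ∃ c ∈ L, (∃ z ∈ CurveClass.range c, hexGauge z ≤ r + ε) ∧
        ∃ z ∈ CurveClass.range c, R - ε ≤ hexGauge z) ∧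
      ¬ ∃ c ∈ L, (∃ z ∈ CurveClass.range c, hexGauge z < r) ∧ ∃ z ∈ CurveClass.range c, R < hexGauge z} ⊆ U \ K := by
    rintro L ⟨hnear, hnot⟩
    constructor
    · obtain ⟨c, hc, ⟨z₁, hz₁, hz₁N⟩, z₂, hz₂, hz₂N⟩ := hnear ε hεpos
      exact mem_interior_loopHexCrossing hc hz₁ (by linarith) hz₂ (by linarith)
    · intro hLK
      obtain ⟨c, hc, ⟨z₁, hz₁, hz₁N⟩, z₂, hz₂, hz₂N⟩ := exists_mem_of_mem_closure_loopHexCrossing hLK hε'pos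
      exact hnot ⟨c, hc, ⟨z₁, hz₁, by linarith⟩, z₂, hz₂, by linarith⟩
  -- portmanteau, open-set half
  have hT : Tendsto (triLoopLaw D) (𝓝[>] 0) (𝓝 ⟨P', inferInstance⟩) :=
    (tendstoLaw_iff_tendsto_triLoopLaw D).1 hconv
  have hport := ProbabilityMeasure.le_liminf_measure_open_of_tendsto hT hG
  refine (measure_mono hsub).trans (hport.trans ?_)
  -- a threshold beyond which the sandwich applies
  obtain ⟨M, hM⟩ := exists_nat_ge (max (6 / ε) (max (1 / (R₁ - r₁)) (max (1 / r₂) (1 / ε'))))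
  have hM1 : 6 / ε ≤ M := le_trans (le_max_left _ _) hM
  have hM2 : 1 / (R₁ - r₁) ≤ M := le_trans ((le_max_left _ _).trans (le_max_right _ _)) hM
  have hM3 : 1 / r₂ ≤ M := le_trans (((le_max_left _ _).trans (le_max_right _ _)).trans (le_max_right _ _)) hM
  have hM4 : 1 / ε' ≤ M := le_trans (((le_max_right _ _).trans (le_max_right _ _)).trans (le_max_right _ _)) hM
  refine le_of_forall_lt_imp_le_of_dense fun a ha ↦ ?_
  have h3 := Filter.eventually_lt_of_lt_liminf ha
  have h4 := tendsto_inv_natCast_nhdsGT_zero.eventually h3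
  refine Filter.le_liminf_of_le (by isBoundedDefault) ?_
  filter_upwards [h4, eventually_ge_atTop (M + 1)] with ρ hρa hρM
  have hρM' : (M : ℝ) + 1 ≤ ρ := by exact_mod_cast hρM
  have hρ1 : 1 ≤ ρ := by omega
  have hρpos : (0 : ℝ) < ρ := by exact_mod_cast (show 0 < ρ by omega)
  have hρinv : (0 : ℝ) < (ρ : ℝ)⁻¹ := inv_pos.2 hρpos
  -- the numerical consequences of `ρ ≥ M + 1`
  have hρε : 6 ≤ (ρ : ℝ) * ε := by
    have : 6 / ε ≤ ρ := by linarith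
    rwa [div_le_iff₀ hεpos] at this
  have hρ2 : 1 ≤ (ρ : ℝ) * (R₁ - r₁) := by
    have : 1 / (R₁ - r₁) ≤ ρ := by linarith
    rwa [div_le_iff₀ (by linarith)] at this
  have hρ3 : 1 ≤ (ρ : ℝ) * r₂ := by
    have : 1 / r₂ ≤ ρ := by linarith
    rwa [div_le_iff₀ h₀] at this
  have hρ4 : 1 ≤ (ρ : ℝ) * ε' := by
    have : 1 / ε' ≤ ρ := by linarith
    rwa [div_le_iff₀ hε'pos] at this
  rw [triLoopLaw_apply hρinv hG.measurableSet] at hρa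
  refine hρa.le.trans (measure_mono ?_)
  rintro ω ⟨hωU, hωK⟩
  -- positivity of the radii and the products with `ρ`
  have hr0 : 0 < r := h₀.trans h₂
  have hr₁0 : 0 < r₁ := hr0.trans h₁
  have hR₁0 : 0 < R₁ := hr₁0.trans h₁₁
  have hR0 : 0 < R := hR₁0.trans H₁
  have hR₂0 : 0 < R₂ := hR0.trans H₂
  have p1 : (ρ : ℝ) * (4 * ε) ≤ ρ * (r₁ - r) := mul_le_mul_of_nonneg_left hε1 hρpos.le
  have p2 : (ρ : ℝ) * (4 * ε) ≤ ρ * (R - R₁) := mul_le_mul_of_nonneg_left hε2 hρpos.le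
  have p3 : (ρ : ℝ) * (4 * ε') ≤ ρ * (r - r₂) := mul_le_mul_of_nonneg_left hε'1 hρpos.le
  have p4 : (ρ : ℝ) * (4 * ε') ≤ ρ * (R₂ - R) := mul_le_mul_of_nonneg_left hε'2 hρpos.le
  have p5 : (ρ : ℝ) * R₁ ≤ ρ * R₂ := mul_le_mul_of_nonneg_left (by linarith) hρpos.le
  have p6 : (ρ : ℝ) * r₂ ≤ ρ * R₂ := mul_le_mul_of_nonneg_left (by linarith) hρpos.le
  have hρ1' : (1 : ℝ) ≤ ρ := by exact_mod_cast hρ1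
  -- integer radii
  have c1 : (ρ : ℝ) * r₁ ≤ ⌈(ρ : ℝ) * r₁⌉₊ := Nat.le_ceil _
  have c1' : (⌈(ρ : ℝ) * r₁⌉₊ : ℝ) < ρ * r₁ + 1 := Nat.ceil_lt_add_one (by positivity)
  have f1 : (⌊(ρ : ℝ) * R₁⌋₊ : ℝ) ≤ ρ * R₁ := Nat.floor_le (by positivity)
  have f2 : (⌊(ρ : ℝ) * r₂⌋₊ : ℝ) ≤ ρ * r₂ := Nat.floor_le (by positivity)
  have c2 : (ρ : ℝ) * R₂ ≤ ⌈(ρ : ℝ) * R₂⌉₊ := Nat.le_ceil _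
  have c2' : (⌈(ρ : ℝ) * R₂⌉₊ : ℝ) < ρ * R₂ + 1 := Nat.ceil_lt_add_one (by positivity)
  constructor
  · -- the inner annulus is crossed
    refine mem_armEvent_of_triLoopCollection_mem_loopHexCrossing hρ1 (a := r + 3 * ε) (b := R - 3 * ε)
      ?_ ?_ ?_ D ?_ (interior_subset hωU)
    · linarith
    · linarith
    · exact Nat.le_floor (by linarith)
    · refine (closedBall_subset_closedBall ?_).trans hD
      rw [div_le_iff₀ hρpos]
      linarith
  · -- the outer annulus is not crossed
    intro harm
    apply hωK
    have h1n : 1 ≤ ⌊(ρ : ℝ) * r₂⌋₊ := Nat.le_floor (by exact_mod_cast hρ3)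
    have hnN : ⌊(ρ : ℝ) * r₂⌋₊ ≤ ⌈(ρ : ℝ) * R₂⌉₊ := by
      have : (⌊(ρ : ℝ) * r₂⌋₊ : ℝ) ≤ ⌈(ρ : ℝ) * R₂⌉₊ := by linarith
      exact_mod_cast this
    have hD' : closedBall (0 : ℂ) ((⌈(ρ : ℝ) * R₂⌉₊ : ℝ) / ρ) ⊆ D.carrier := by
      refine (closedBall_subset_closedBall ?_).trans hD
      rw [div_le_iff₀ hρpos]
      linarith
    have hcross := triLoopCollection_mem_loopHexCrossing_of_mem_armEvent h1n hnN hρ1 D hD' harm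
    refine subset_closure (loopHexCrossing_mono ?_ ?_ hcross)
    · rw [div_le_iff₀ hρpos]; linarith
    · rw [le_div_iff₀ hρpos]; linarith

/-- **Hypothesis (b) from lattice equicontinuity.** If for every `θ > 0` there are radii
`0 < r₂ < r < r₁ < R₁ < R < R₂ ≤ R + 1` for which the lattice inextendability probability
`P[armEvent ⌈ρr₁⌉ ⌊ρR₁⌋ ∖ armEvent ⌊ρr₂⌋ ⌈ρR₂⌉]` has `liminf_ρ ≤ θ`, then the near-miss event of
the hexagonal annulus `(r, R)` is null for every limit law `P'` of the loop collections in a domain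
`D ⊇ B̄(0, R + 2)`. [cite: CamiaNewman2006, §6] -/
theorem measure_nearMiss_eq_zero_of_lattice (D : JordanDomain) {r R : ℝ} (hD : closedBall (0 : ℂ) (R + 2) ⊆ D.carrier)
    {P' : Measure (LoopSpace ℂ)} [IsProbabilityMeasure P']
    (hconv : TendstoLaw (Ωδ := fun _ ↦ SiteConfig (Site 2)) (fun δ ↦ triLoopCollection D δ)
      (fun _ ↦ triSitePercolation half) id P')
    (h : ∀ θ : ℝ≥0∞, 0 < θ → ∃ r₂ r₁ R₁ R₂ : ℝ, 0 < r₂ ∧ r₂ < r ∧ r < r₁ ∧ r₁ < R₁ ∧ R₁ < R ∧ R < R₂ ∧ R₂ ≤ R + 1 ∧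
      liminf (fun ρ : ℕ ↦ triSitePercolation half
        (armEvent ![true, false] ⌈(ρ : ℝ) * r₁⌉₊ ⌊(ρ : ℝ) * R₁⌋₊ \
          armEvent ![true, false] ⌊(ρ : ℝ) * r₂⌋₊ ⌈(ρ : ℝ) * R₂⌉₊)) atTop ≤ θ) :
    P' {L : LoopSpace ℂ | (∀ ε > 0, ∃ c ∈ L, (∃ z ∈ CurveClass.range c, hexGauge z ≤ r + ε) ∧
        ∃ z ∈ CurveClass.range c, R - ε ≤ hexGauge z) ∧
      ¬ ∃ c ∈ L, (∃ z ∈ CurveClass.range c, hexGauge z < r) ∧ ∃ z ∈ CurveClass.range c, R < hexGauge z} = 0 := by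
  by_contra hne
  set m := P' {L : LoopSpace ℂ | (∀ ε > 0, ∃ c ∈ L, (∃ z ∈ CurveClass.range c, hexGauge z ≤ r + ε) ∧
        ∃ z ∈ CurveClass.range c, R - ε ≤ hexGauge z) ∧
      ¬ ∃ c ∈ L, (∃ z ∈ CurveClass.range c, hexGauge z < r) ∧ ∃ z ∈ CurveClass.range c, R < hexGauge z} with hm
  have hm0 : m ≠ 0 := hne
  have hmtop : m ≠ ∞ := measure_ne_top _ _
  obtain ⟨r₂, r₁, R₁, R₂, h0, h2, h1, h11, H1, H2, H3, hlim⟩ := h (m / 2) (ENNReal.half_pos hm0)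
  have hle := measure_nearMiss_le_liminf D (R₂ := R₂) ((closedBall_subset_closedBall (by linarith)).trans hD)
    hconv h0 h2 h1 h11 H1 H2
  have : m ≤ m / 2 := hle.trans hlim
  exact absurd this (not_le.2 (ENNReal.half_lt_self hm0 hmtop))

/-! ### The named fact with hypothesis (b) replaced by the lattice equicontinuity -/

/-- **`SmirnovWerner2001_twoArm_scalingLimit` from the loop limit, a lattice equicontinuity and
the continuum exponent.** As `SmirnovWerner2001_twoArm_scalingLimit_of_loopLimit`, with the
continuum no-touching hypothesis (b) replaced by its lattice source
(`measure_nearMiss_eq_zero_of_lattice`): for all integers `1 ≤ r < R` and every `θ > 0` there are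
radii `0 < r₂ < r < r₁ < R₁ < R < R₂ ≤ R + 1` such that
`liminf_ρ P[armEvent ⌈ρr₁⌉ ⌊ρR₁⌋ ∖ armEvent ⌊ρr₂⌋ ⌈ρR₂⌉] ≤ θ` (two arms of opposite colours across
the annulus `[ρr₁, ρR₁]` that cannot be extended across `[ρr₂, ρR₂]` are unlikely for nearby radii,
uniformly in the scale — on the lattice a consequence of the half-plane three-arm bound,
`LawlerSchrammWerner2002_halfPlane_threeArm`, not derived here). [cite: SmirnovWernerMRL2001, §4 (9), (16)] -/
theorem SmirnovWerner2001_twoArm_scalingLimit_of_loopLimit_of_lattice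
    (ν : JordanDomain → Measure (LoopSpace ℂ)) (hν : ∀ D, IsProbabilityMeasure (ν D))
    (hconv : ∀ D : JordanDomain, TendstoLaw (Ωδ := fun _ ↦ SiteConfig (Site 2))
      (fun δ ↦ triLoopCollection D δ) (fun _ ↦ triSitePercolation half) id (ν D))
    (Dn : ℕ → JordanDomain) (hDn : ∀ n : ℕ, closedBall (0 : ℂ) (n + 2) ⊆ (Dn n).carrier)
    (hlat : ∀ r R : ℕ, 1 ≤ r → r < R → ∀ θ : ℝ≥0∞, 0 < θ →
      ∃ r₂ r₁ R₁ R₂ : ℝ, 0 < r₂ ∧ r₂ < r ∧ (r : ℝ) < r₁ ∧ r₁ < R₁ ∧ R₁ < R ∧ (R : ℝ) < R₂ ∧ R₂ ≤ R + 1 ∧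
        liminf (fun ρ : ℕ ↦ triSitePercolation half
          (armEvent ![true, false] ⌈(ρ : ℝ) * r₁⌉₊ ⌊(ρ : ℝ) * R₁⌋₊ \
            armEvent ![true, false] ⌊(ρ : ℝ) * r₂⌋₊ ⌈(ρ : ℝ) * R₂⌉₊)) atTop ≤ θ)
    (hexp : Tendsto (fun n : ℕ ↦ Real.log ((ν (Dn n)).real (loopHexCrossing (1 : ℝ) (n : ℝ))) / Real.log n)
      atTop (𝓝 (-(1 / 4)))) :
    SmirnovWerner2001_twoArm_scalingLimit := by
  refine SmirnovWerner2001_twoArm_scalingLimit_of_loopLimit ν hν hconv Dn hDn (fun r R hr hrR ↦ ?_) hexp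
  haveI := hν (Dn R)
  exact measure_nearMiss_eq_zero_of_lattice (Dn R) (hDn R) (hconv (Dn R)) (hlat r R hr hrR)

/-- **The named fact from `exists_isCNLFamily_tendsto`, the lattice equicontinuity and the
continuum exponent** (the exponent being required of every CNL scaling limit, of which there is at
most one, `cnlFamily_unique`). [cite: SmirnovWernerMRL2001, §4 (9), (16)] -/
theorem SmirnovWerner2001_twoArm_scalingLimit_of_cnl_of_lattice (h : exists_isCNLFamily_tendsto)
    (Dn : ℕ → JordanDomain) (hDn : ∀ n : ℕ, closedBall (0 : ℂ) (n + 2) ⊆ (Dn n).carrier)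
    (hlat : ∀ r R : ℕ, 1 ≤ r → r < R → ∀ θ : ℝ≥0∞, 0 < θ →
      ∃ r₂ r₁ R₁ R₂ : ℝ, 0 < r₂ ∧ r₂ < r ∧ (r : ℝ) < r₁ ∧ r₁ < R₁ ∧ R₁ < R ∧ (R : ℝ) < R₂ ∧ R₂ ≤ R + 1 ∧
        liminf (fun ρ : ℕ ↦ triSitePercolation half
          (armEvent ![true, false] ⌈(ρ : ℝ) * r₁⌉₊ ⌊(ρ : ℝ) * R₁⌋₊ \
            armEvent ![true, false] ⌊(ρ : ℝ) * r₂⌋₊ ⌈(ρ : ℝ) * R₂⌉₊)) atTop ≤ θ)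
    (hexp : ∀ ν : JordanDomain → Measure (LoopSpace ℂ), IsCNLFamily ν →
      (∀ D : JordanDomain, TendstoLaw (Ωδ := fun _ ↦ SiteConfig (Site 2))
        (fun δ ↦ triLoopCollection D δ) (fun _ ↦ triSitePercolation half) id (ν D)) →
      Tendsto (fun n : ℕ ↦ Real.log ((ν (Dn n)).real (loopHexCrossing (1 : ℝ) (n : ℝ))) / Real.log n)
        atTop (𝓝 (-(1 / 4)))) :
    SmirnovWerner2001_twoArm_scalingLimit := by
  obtain ⟨ν, hν, hconv⟩ := h
  exact SmirnovWerner2001_twoArm_scalingLimit_of_loopLimit_of_lattice ν hν.isProbabilityMeasure hconv Dn hDn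
    hlat (hexp ν hν hconv)

end Literature.Probability.Percolation
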